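import Literature.NumberTheory.Automorphic.StrongArtinGL2
import Literature.NumberTheory.GaloisRepresentations.ArtinRepCoefficientTransport
import HarnessLib

/-!
# The Langlands–Tunnell theorem for `p`-adic coefficients

Topic `Literature/NumberTheory/Automorphic`; namespace `Literature.NumberTheory.Automorphic`.
A theorems-only file (no definition of a notion, no named fact; D-0026): the tree's
Langlands–Tunnell predicate `langlands_tunnell ρ` (lang.S30, `Automorphic/LanglandsTunnell`:
an odd irreducible continuous `ρ : Γ_ℚ → GL₂(ℂ)` with solvable image is attached to a
weight-one newform) transported to FINITE-IMAGE `p`-adic representations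
`ρ₁ : Γ_ℚ → GL₂(ℚ̄_p)` — the form in which it is consumed by `p`-adic arguments ("via a fixed
isomorphism `ι : ℚ̄_p ≅ ℂ`"; Deligne–Serre 1974, §8.7; Wiles 1995, Ch. 5 for `p = 3`; Allen 2014,
§5.1.1, p. 70: "`ρ₁ = Ind χ ξ` … A classical construction yields a cuspidal Hilbert modular
newform `f₁` of weight `((1,…,1),(0,…,0))`, such that `ρ_{f₁} ≅ ρ₁`", `ρ₁` being `2`-adic).

* `exists_weightOne_newform_of_langlands_tunnell` — granted `∀ σ, langlands_tunnell σ`: every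
  continuous `ρ₁ : Γ_ℚ → GL₂(ℚ̄_p)` with open kernel (finite image), without common eigenvector
  (irreducible), odd, and with solvable image is attached to a weight-one newform
  `f ∈ S₁(Γ₁(N))` away from `N` via some coefficient embedding `ι_f : K_f → ℚ̄_p`
  (`IsGaloisRepOfNewform1 f ι_f {q ∣ N} ρ₁`).  Proof: choose `ψ : ℚ̄_p ≃+* ℂ`
  (`PadicAlgCl.nonempty_ringEquiv_complex`), push `ρ₁` to the complex model
  `ρℂ = GL₂(ψ) ∘ ρ₁` (continuous because the kernel is open,
  `FramedGaloisRep.exists_complex_model_of_isOpen_ker`), which is irreducible, odd and solvable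
  (`hasCommonEigenvector_map_ringEquiv_iff`, `FramedGaloisRep.isOdd_of_map`,
  `FramedGaloisRep.isSolvable_range_of_map`), apply `langlands_tunnell ρℂ`, and pull the
  conclusion back along `ψ⁻¹` (`IsGaloisRepOfNewform1.of_map`, `ι_f = ψ⁻¹ ∘ (K_f ⊆ ℂ)`).
* `exists_weightOne_newform_of_strongArtin` — the same from the three closed named facts
  through which the tree carries the Langlands–Tunnell debt (`strongArtin_of_isSolvable`,
  `frobSatakeCompatibleAt_of_isPiOfArtinRep`, `exists_isNewform1_of_isPiOfArtinRep`;
  `langlands_tunnell_of_strongArtin`, `Automorphic/StrongArtinGL2`).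
* `exists_weightOne_newform_of_isReductionOf_of_monomial` — the instance met in Allen's
  Lemma 87 over `ℚ`: `ρ₁` odd with open kernel, MONOMIAL (its integral model is diagonal on a
  subgroup of index two — `ρ₁ ≅ Ind_{G_L}^{G_ℚ} ψ`, so the image is solvable,
  `isSolvable_range_of_monomial_map`) and lifting a residual representation without common
  eigenvector (so `ρ₁` is irreducible, `FramedGaloisRep.not_hasCommonEigenvector_of_isReductionOf`).

Nothing here claims `langlands_tunnell` (lang.S30) or the strong Artin facts.

## References

* P. Deligne, J.-P. Serre, Ann. Sci. ÉNS (4) 7 (1974), §8.7. [DeligneSerreASENS1974]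
* S. Gelbart, in Cornell–Silverman–Stevens (1997), Thm. 1.3, §2.6, Prop. 4.2. [Gelbart1997]
* P. B. Allen, Compositio Math. 150 (2014) = arXiv:1301.1113v2, §5.1.1, Lemma 87, p. 70.
  [Allen2014]
-/

noncomputable section

open scoped MatrixGroups NumberField ModularForm
open NumberField IsDedekindDomain Field CongruenceSubgroup

namespace Literature.NumberTheory.Automorphic

open Literature.NumberTheory.GaloisRepresentations
open Literature.NumberTheory.EllipticCurves.ModularForms

variable {p : ℕ} [Fact p.Prime]

/-- **Langlands–Tunnell for finite-image `p`-adic representations.**  Granted the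
Langlands–Tunnell theorem `langlands_tunnell` (lang.S30) for every complex `σ`: a continuous
`ρ₁ : Γ_ℚ → GL₂(ℚ̄_p)` with open kernel, no common eigenvector, odd, and with solvable image is
attached to a weight-one newform `f ∈ S₁(Γ₁(N))` away from `N` via a coefficient embedding
`ι_f : K_f → ℚ̄_p` — transport through an abstract isomorphism `ψ : ℚ̄_p ≅ ℂ` (module
docstring). [cite: Gelbart1997, Thm. 1.3 and §2.6] [cite: DeligneSerreASENS1974, §8.7] -/
theorem exists_weightOne_newform_of_langlands_tunnell (hLT : ∀ σ, langlands_tunnell σ)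
    (ρ₁ : FramedGaloisRep ℚ (PadicAlgCl p) 2)
    (hopen : IsOpen ((ρ₁ : absoluteGaloisGroup ℚ →* GL (Fin 2) (PadicAlgCl p)).ker :
      Set (absoluteGaloisGroup ℚ)))
    (hirr : ¬ HasCommonEigenvector (ρ₁ : absoluteGaloisGroup ℚ →* GL (Fin 2) (PadicAlgCl p)))
    (hodd : ρ₁.IsOdd)
    (hsolv : IsSolvable (ρ₁ : absoluteGaloisGroup ℚ →* GL (Fin 2) (PadicAlgCl p)).range) :
    ∃ (N : ℕ) (_ : NeZero N) (f : CuspForm (Gamma1 N) 1)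
      (ιf : coeffCharField f →+* PadicAlgCl p),
      IsNewform1 f ∧ IsGaloisRepOfNewform1 f ιf {q | q ∣ N} ρ₁ := by
  obtain ⟨ψ, ρℂ, hρℂ, hback, -, -⟩ := ρ₁.exists_complex_model_of_isOpen_ker hopen
  have heq : (ρℂ : absoluteGaloisGroup ℚ →* GL (Fin 2) ℂ) =
      (Matrix.GeneralLinearGroup.map (ψ : PadicAlgCl p →+* ℂ)).comp
        (ρ₁ : absoluteGaloisGroup ℚ →* GL (Fin 2) (PadicAlgCl p)) :=
    MonoidHom.ext fun σ => hρℂ σ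
  have hceℂ : ¬ HasCommonEigenvector (ρℂ : absoluteGaloisGroup ℚ →* GL (Fin 2) ℂ) := by
    rw [heq, hasCommonEigenvector_map_ringEquiv_iff]
    exact hirr
  have hirrℂ : ρℂ.toGaloisRep.IsIrreducible :=
    (isIrreducible_iff_not_hasCommonEigenvector
      (ρℂ : absoluteGaloisGroup ℚ →* GL (Fin 2) ℂ)).2 hceℂ
  have hoddℂ : ρℂ.IsOdd := FramedGaloisRep.isOdd_of_map hρℂ hodd
  have hsolvℂ : IsSolvable (MonoidHom.range (ρℂ : absoluteGaloisGroup ℚ →* GL (Fin 2) ℂ)) :=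
    FramedGaloisRep.isSolvable_range_of_map hρℂ hsolv
  obtain ⟨N, hN, f, hf, hρf⟩ := hLT ρℂ hirrℂ hoddℂ hsolvℂ
  exact ⟨N, hN, f, (ψ.symm : ℂ →+* PadicAlgCl p).comp (algebraMap (coeffCharField f) ℂ), hf,
    hρf.of_map _ hback⟩

/-- The same from the closed named facts carrying the Langlands–Tunnell debt in the tree:
Gelbart's Thm. 2.1 (`strongArtin_of_isSolvable`), Prop. 4.1
(`frobSatakeCompatibleAt_of_isPiOfArtinRep`) and Prop. 4.2 (`exists_isNewform1_of_isPiOfArtinRep`),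
via `langlands_tunnell_of_strongArtin`. [cite: Gelbart1997, Thm. 2.1, §2.6 and Prop. 4.2] -/
theorem exists_weightOne_newform_of_strongArtin (hSA : strongArtin_of_isSolvable)
    (hAE : frobSatakeCompatibleAt_of_isPiOfArtinRep) (hW1 : exists_isNewform1_of_isPiOfArtinRep)
    (ρ₁ : FramedGaloisRep ℚ (PadicAlgCl p) 2)
    (hopen : IsOpen ((ρ₁ : absoluteGaloisGroup ℚ →* GL (Fin 2) (PadicAlgCl p)).ker :
      Set (absoluteGaloisGroup ℚ)))
    (hirr : ¬ HasCommonEigenvector (ρ₁ : absoluteGaloisGroup ℚ →* GL (Fin 2) (PadicAlgCl p)))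
    (hodd : ρ₁.IsOdd)
    (hsolv : IsSolvable (ρ₁ : absoluteGaloisGroup ℚ →* GL (Fin 2) (PadicAlgCl p)).range) :
    ∃ (N : ℕ) (_ : NeZero N) (f : CuspForm (Gamma1 N) 1)
      (ιf : coeffCharField f →+* PadicAlgCl p),
      IsNewform1 f ∧ IsGaloisRepOfNewform1 f ιf {q | q ∣ N} ρ₁ :=
  exists_weightOne_newform_of_langlands_tunnell (langlands_tunnell_of_strongArtin hSA hAE hW1) ρ₁
    hopen hirr hodd hsolv

/-- **The instance of Allen's Lemma 87 over `ℚ`** (p. 70: "We set `ρ₁ = Ind χ ξ` … `ρ₁` is a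
lift of `ρ̄` … totally odd … A classical construction yields a cuspidal … newform `f₁` of weight
one such that `ρ_{f₁} ≅ ρ₁`"): granted `langlands_tunnell`, a continuous odd
`ρ₁ : Γ_ℚ → GL₂(ℚ̄_p)` with open kernel whose integral model `ρ₀'` is MONOMIAL — diagonal on a
subgroup `Hm` of index two, i.e. `ρ₁ ≅ Ind_{G_L}^{G_ℚ} ψ` for the quadratic field `L = ℚ̄^{Hm}`,
whence solvable image (`isSolvable_range_of_monomial_map`) — and which has a reduction `τ`
without common eigenvector (whence `ρ₁` is irreducible,
`FramedGaloisRep.not_hasCommonEigenvector_of_isReductionOf`) is attached to a weight-one newform.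
(For dihedral `ρ₁` the "classical construction" is Hecke's theta series of `L` / the dihedral case
of the strong Artin conjecture, Jacquet–Langlands §12; the solvable Langlands–Tunnell theorem used
here contains it.) [cite: Allen2014, Lemma 87 (arXiv:1301.1113v2, §5.1.1, p. 70)] -/
theorem exists_weightOne_newform_of_isReductionOf_of_monomial (hLT : ∀ σ, langlands_tunnell σ)
    {k : Type*} [Field k] (ρ₁ : FramedGaloisRep ℚ (PadicAlgCl p) 2)
    (ρ₀' : absoluteGaloisGroup ℚ →* GL (Fin 2) (padicAlgClIntegers p))
    (hmap : ∀ σ, Matrix.GeneralLinearGroup.map (padicAlgClIntegers p).subtype (ρ₀' σ) = ρ₁ σ)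
    (hopen : IsOpen ((ρ₁ : absoluteGaloisGroup ℚ →* GL (Fin 2) (PadicAlgCl p)).ker :
      Set (absoluteGaloisGroup ℚ)))
    (Hm : Subgroup (absoluteGaloisGroup ℚ)) (hHm : Hm.index = 2)
    (hdg : ∀ h ∈ Hm, (ρ₀' h).val 0 1 = 0 ∧ (ρ₀' h).val 1 0 = 0) (hodd : ρ₁.IsOdd)
    {ι : padicAlgClResidueField p →+* k} {τ : absoluteGaloisGroup ℚ →* GL (Fin 2) k}
    (hred : ρ₁.IsReductionOf ι τ) (hce : ¬ HasCommonEigenvector τ) :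
    ∃ (N : ℕ) (_ : NeZero N) (f : CuspForm (Gamma1 N) 1)
      (ιf : coeffCharField f →+* PadicAlgCl p),
      IsNewform1 f ∧ IsGaloisRepOfNewform1 f ιf {q | q ∣ N} ρ₁ :=
  exists_weightOne_newform_of_langlands_tunnell hLT ρ₁ hopen
    (ρ₁.not_hasCommonEigenvector_of_isReductionOf hred hce) hodd
    (isSolvable_range_of_monomial_map (padicAlgClIntegers p).subtype ρ₀' _ hmap Hm hHm hdg)

end Literature.NumberTheory.Automorphic

end
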